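import Summits.ResolutionOfSingularities.ResolutionOfSingularities.Theorems.DescentDescentPerfectToAllResidualWitnessMacLane
import HarnessLib

/-!
# `DescentPerfectToAll` (stmt-ResolutionOfSingularities-0549): Mac Lane's field `S₁` — a residual inhabitant of
# INFINITE `p`-rank that no level essentially of finite type over a perfect field reaches (part 2: the witness)

Route `ResolutionOfSingularities/Descent`, crux `DescentPerfectToAll`. Helper (OURS; not a statement of any
manuscript; `--supports` the crux, does not close it). Sequel of `DescentDescentPerfectToAllResidualWitnessMacLane`
(the tower `𝓛 = 𝔽_p(T, Y) ⊆ A = Frac(𝔽_p[s₀, s₁, …])`, `t_n = s_n^p`, `y_n = s_n + s_{n+1} s_{n+2}^p`; the forcing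
lemma; `s_n ∉ 𝓛`). Answers RUNG-B-LIT §11b (res-lit-3, 2026-08-27) offer O1.

* `mem_macLaneLevel_of_macLane` — a Mac Lane-separable level `E ∋ t₀, t₁` of `𝓛` contains every `t_n` and every
  `y_n` (induction with the forcing lemma on `t_n = y_n^p + (−t_{n+2})^p t_{n+1}`, `t_{n+1} ∉ 𝓛^p`);
* `exists_eq_div_of_isLocalization_adjoin` — a level `E` that is the localisation of `k₀[σ]`, `k₀` perfect,
  `σ` finite, consists of quotients of `D`-constants as soon as the generators `σ` do (the image of `k₀` is made
  of `p`-th powers), for any derivation `D` of `𝔽_p[s]`;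
* `not_exhaustedByEssFiniteType_of_eq_macLaneField`, `exists_macLaneField_not_exhaustedByEssFiniteType` — **THE
  WITNESS** (the bare `∃ k, …` packaging would restate the TYPE of `exists_field_not_exhaustedByEssFiniteType`, so the
  packaged form keeps the defining equation `L = closure(T ∪ Y)`): `𝓛` is not EFT-separably exhausted
  (the residual class of `descentPerfectToAll_iff_residual`, verbatim shape). If `E ∋ t₀, t₁` were essentially of
  finite type over a perfect `k₀` with `𝓛/E` Mac Lane-separable: the generators of `E` lie in
  `closure(T ∪ {y_k : k < M})` for some `M`, so every element of `E` is `a/b` with `∂a/∂s_{M+1} = ∂b/∂s_{M+1}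
  = 0` — but `y_M ∈ E` and `∂y_M/∂s_{M+1} = s_{M+2}^p ≠ 0`.

Why it matters for pricing the crux (reading, OURS): the one-step mechanism "model over a level `E` +
separable ascent" (`hasResolution_of_perfectRes_of_exhaustedByEssFiniteType` and its evident extension to
any class of levels) cannot move an `𝓛`-scheme presented over `𝔽_p(t₀, t₁)` to ANY level essentially of finite
type over a perfect field — the levels forced by Mac Lane separability swallow the whole tower
`y₀, y₁, …`; `𝓛` has infinite `p`-rank (the `y_n` are `p`-independent — not needed here, not proved here) and
lies outside the finite-transcendence-degree dichotomy of `DescentDescentPerfectToAllPerfectCoreResidual`. No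
claim about the crux itself is made; nothing here is a statement of Hironaka's manuscript.
[cite: MacLane1939SteinitzTowers, §8 (1), Lemma 8.4, Lemma 8.5] [cite: MacLane1939ModularFieldsI, §4 Thm 7
(iii); §7 Example (1)] [cite: Matsumura1987, Thm. 26.4]
-/

noncomputable section

set_option linter.dupNamespace false -- mandated namespace of this single-conjunct summit

open MvPolynomial

namespace Summit.ResolutionOfSingularities.ResolutionOfSingularities.Theorems

variable (p : ℕ) [Fact p.Prime]

/-! ## 1 The forced tower and levels essentially of finite type -/

/-- **A Mac Lane-separable level containing `t₀, t₁` contains the whole tower.** For `L = 𝓛` and `E ≤ L`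
containing `t₀, t₁` with `L/E` separable in Mac Lane's sense, `t_n, y_n ∈ E` for every `n` (induction with the
forcing lemma on `t_n = y_n^p + (−t_{n+2})^p·t_{n+1}`, `t_{n+1} ∉ L^p`); membership is stated through
`E.map L.subtype ≤ A`. [cite: MacLane1939ModularFieldsI, §4 Thm 7 (iii)] [cite: MacLane1939SteinitzTowers, §8 Lemma 8.4] -/
theorem mem_macLaneLevel_of_macLane (L : Subfield (FractionRing (MvPolynomial ℕ (ZMod p)))) (hL : L = Subfield.closure (algebraMap (MvPolynomial ℕ (ZMod p)) (FractionRing (MvPolynomial ℕ (ZMod p))) '' ({q | ∃ j : ℕ, q = X j ^ p} ∪ {q | ∃ k : ℕ, q = X k + X (k + 1) * X (k + 2) ^ p})))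
    (E : Subfield L)
    (hML : ∀ u : Finset L, LinearIndepOn E _root_.id (↑u : Set L) →
      LinearIndepOn E (fun x : L => x ^ p) (↑u : Set L))
    (h0 : algebraMap (MvPolynomial ℕ (ZMod p)) (FractionRing (MvPolynomial ℕ (ZMod p))) (X 0) ^ p ∈ E.map L.subtype)
    (h1 : algebraMap (MvPolynomial ℕ (ZMod p)) (FractionRing (MvPolynomial ℕ (ZMod p))) (X 1) ^ p ∈ E.map L.subtype) (n : ℕ) :
    algebraMap (MvPolynomial ℕ (ZMod p)) (FractionRing (MvPolynomial ℕ (ZMod p))) (X n) ^ p ∈ E.map L.subtype ∧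
      algebraMap (MvPolynomial ℕ (ZMod p)) (FractionRing (MvPolynomial ℕ (ZMod p))) (X n + X (n + 1) * X (n + 2) ^ p) ∈ E.map L.subtype := by
  classical
  have hp : p.Prime := Fact.out
  haveI : CharP (FractionRing (MvPolynomial ℕ (ZMod p))) p := charP_of_injective_algebraMap (IsFractionRing.injective (MvPolynomial ℕ (ZMod p)) _) p
  haveI : CharP L p := L.subtype.charP Subtype.val_injective p
  -- membership of the generators in `L`
  have htL : ∀ j : ℕ, algebraMap (MvPolynomial ℕ (ZMod p)) (FractionRing (MvPolynomial ℕ (ZMod p))) (X j) ^ p ∈ L := fun j => by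
    rw [hL, ← map_pow]; exact Subfield.subset_closure ⟨_, Or.inl ⟨j, rfl⟩, rfl⟩
  have hyL : ∀ k : ℕ, algebraMap (MvPolynomial ℕ (ZMod p)) (FractionRing (MvPolynomial ℕ (ZMod p))) (X k + X (k + 1) * X (k + 2) ^ p) ∈ L := fun k => by
    rw [hL]; exact Subfield.subset_closure ⟨_, Or.inr ⟨k, rfl⟩, rfl⟩
  -- translating membership in `E.map L.subtype`
  have hin : ∀ {v : FractionRing (MvPolynomial ℕ (ZMod p))} (hv : v ∈ L), v ∈ E.map L.subtype ↔ (⟨v, hv⟩ : L) ∈ E := by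
    intro v hv
    constructor
    · intro h
      obtain ⟨y, hy, hyv⟩ := Subfield.mem_map.1 h
      have : y = ⟨v, hv⟩ := Subtype.ext hyv
      exact this ▸ hy
    · intro h
      exact Subfield.mem_map.2 ⟨⟨v, hv⟩, h, rfl⟩
  have h0' : (⟨algebraMap (MvPolynomial ℕ (ZMod p)) (FractionRing (MvPolynomial ℕ (ZMod p))) (X 0) ^ p, htL 0⟩ : L) ∈ E := (hin (htL 0)).1 h0
  have h1' : (⟨algebraMap (MvPolynomial ℕ (ZMod p)) (FractionRing (MvPolynomial ℕ (ZMod p))) (X 1) ^ p, htL 1⟩ : L) ∈ E := (hin (htL 1)).1 h1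
  -- the relation and the non-`p`-th-power, at every `n`
  have hrel : ∀ n : ℕ, (⟨algebraMap (MvPolynomial ℕ (ZMod p)) (FractionRing (MvPolynomial ℕ (ZMod p))) (X n) ^ p, htL n⟩ : L) =
      (⟨algebraMap (MvPolynomial ℕ (ZMod p)) (FractionRing (MvPolynomial ℕ (ZMod p))) (X n + X (n + 1) * X (n + 2) ^ p), hyL n⟩ : L) ^ p +
        (-(⟨algebraMap (MvPolynomial ℕ (ZMod p)) (FractionRing (MvPolynomial ℕ (ZMod p))) (X (n + 2)) ^ p, htL (n + 2)⟩ : L)) ^ p * ⟨algebraMap (MvPolynomial ℕ (ZMod p)) (FractionRing (MvPolynomial ℕ (ZMod p))) (X (n + 1)) ^ p, htL (n + 1)⟩ := by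
    intro n
    apply Subtype.ext
    simp only [Subfield.coe_add, Subfield.coe_mul, SubmonoidClass.coe_pow, Subfield.coe_neg]
    exact macLaneY_pow p n
  have hbp : ∀ (n : ℕ) (z : L), z ^ p ≠ (⟨algebraMap (MvPolynomial ℕ (ZMod p)) (FractionRing (MvPolynomial ℕ (ZMod p))) (X (n + 1)) ^ p, htL (n + 1)⟩ : L) := by
    intro n z hz
    have hz' : (z : FractionRing (MvPolynomial ℕ (ZMod p))) ^ p = algebraMap (MvPolynomial ℕ (ZMod p)) (FractionRing (MvPolynomial ℕ (ZMod p))) (X (n + 1)) ^ p := by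
      have := congrArg (fun x : L => (x : FractionRing (MvPolynomial ℕ (ZMod p)))) hz
      simpa using this
    have hzz : (z : FractionRing (MvPolynomial ℕ (ZMod p))) = algebraMap (MvPolynomial ℕ (ZMod p)) (FractionRing (MvPolynomial ℕ (ZMod p))) (X (n + 1)) := frobenius_inj _ p hz'
    have hnot := algebraMap_X_not_mem_macLaneField p (n + 1)
    rw [← hL] at hnot
    exact hnot (hzz ▸ z.2)
  -- the induction `t_n, t_{n+1} ∈ E`
  have key : ∀ n, (⟨algebraMap (MvPolynomial ℕ (ZMod p)) (FractionRing (MvPolynomial ℕ (ZMod p))) (X n) ^ p, htL n⟩ : L) ∈ E ∧ (⟨algebraMap (MvPolynomial ℕ (ZMod p)) (FractionRing (MvPolynomial ℕ (ZMod p))) (X (n + 1)) ^ p, htL (n + 1)⟩ : L) ∈ E := by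
    intro n
    induction n with
    | zero => exact ⟨h0', h1'⟩
    | succ n ih =>
      refine ⟨ih.2, ?_⟩
      have := mem_of_eq_frobenius_add_frobenius_mul p E hML ih.1 ih.2 (hrel n) (hbp n)
      have hneg := E.neg_mem this.2
      rw [neg_neg] at hneg
      exact hneg
  refine ⟨(hin (htL n)).2 (key n).1, (hin (hyL n)).2 ?_⟩
  exact (mem_of_eq_frobenius_add_frobenius_mul p E hML (key n).1 (key n).2 (hrel n) (hbp n)).1

set_option maxHeartbeats 400000 in
/-- **Levels essentially of finite type are made of `D`-constant quotients.** Let `E ≤ L ≤ A = Frac(𝔽_p[s])`,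
`k₀` a perfect field with `E` the localisation of `k₀[σ]` for a finite `σ ⊆ E`, and `D` a derivation of `𝔽_p[s]`.
If every generator `e ∈ σ` is a quotient `a/b` of `D`-constants, then so is every element of `E` (the image of
`k₀` consists of `p`-th powers, which are `D`-constant quotients; sums, products and inverses preserve the
property). [folklore] -/
theorem exists_eq_div_of_isLocalization_adjoin (L : Subfield (FractionRing (MvPolynomial ℕ (ZMod p)))) (E : Subfield L)
    (k₀ : Type) [Field k₀] [PerfectField k₀] [Algebra k₀ E] (σ : Finset E)
    [IsLocalization ((IsUnit.submonoid E).comap (algebraMap (Algebra.adjoin k₀ (σ : Set E)) E)) E]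
    (D : Derivation ℤ (MvPolynomial ℕ (ZMod p)) (MvPolynomial ℕ (ZMod p)))
    (hσ : ∀ e ∈ σ, ∃ a b : MvPolynomial ℕ (ZMod p), D a = 0 ∧ D b = 0 ∧
      algebraMap (MvPolynomial ℕ (ZMod p)) (FractionRing (MvPolynomial ℕ (ZMod p))) a / algebraMap (MvPolynomial ℕ (ZMod p)) (FractionRing (MvPolynomial ℕ (ZMod p))) b = ((e : L) : FractionRing (MvPolynomial ℕ (ZMod p))))
    (x : E) :
    ∃ a b : MvPolynomial ℕ (ZMod p), D a = 0 ∧ D b = 0 ∧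
      algebraMap (MvPolynomial ℕ (ZMod p)) (FractionRing (MvPolynomial ℕ (ZMod p))) a / algebraMap (MvPolynomial ℕ (ZMod p)) (FractionRing (MvPolynomial ℕ (ZMod p))) b = ((x : L) : FractionRing (MvPolynomial ℕ (ZMod p))) := by
  classical
  have hp : p.Prime := Fact.out
  haveI : CharP (FractionRing (MvPolynomial ℕ (ZMod p))) p :=
    charP_of_injective_algebraMap (IsFractionRing.injective (MvPolynomial ℕ (ZMod p)) _) p
  haveI : CharP L p := L.subtype.charP Subtype.val_injective p
  haveI : CharP E p := E.subtype.charP Subtype.val_injective p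
  haveI : CharP k₀ p := (algebraMap k₀ E).charP (algebraMap k₀ E).injective p
  haveI : ExpChar k₀ p := ExpChar.prime hp
  -- the predicate "quotient of two `D`-constants"
  let P : FractionRing (MvPolynomial ℕ (ZMod p)) → Prop := fun x =>
    ∃ a b : MvPolynomial ℕ (ZMod p), D a = 0 ∧ D b = 0 ∧ algebraMap (MvPolynomial ℕ (ZMod p)) (FractionRing (MvPolynomial ℕ (ZMod p))) a / algebraMap (MvPolynomial ℕ (ZMod p)) (FractionRing (MvPolynomial ℕ (ZMod p))) b = x
  obtain ⟨⟨hP0, hP1⟩, hPadd, hPmul, hPneg, hPinv, hPpow⟩ := divConst_closure D P (fun x => Iff.rfl)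
  -- `P` holds on the image of `k₀` (p-th powers)
  have hPk₀ : ∀ r : k₀, P (((algebraMap k₀ E r : E) : L) : FractionRing (MvPolynomial ℕ (ZMod p))) := by
    intro r
    obtain ⟨w, hw⟩ := surjective_frobenius k₀ p r
    have : (((algebraMap k₀ E r : E) : L) : FractionRing (MvPolynomial ℕ (ZMod p))) =
        ((((algebraMap k₀ E w : E) : L) : FractionRing (MvPolynomial ℕ (ZMod p)))) ^ p := by
      rw [← hw, frobenius_def, map_pow]; rfl
    rw [this]
    exact hPpow p _ (fun q => derivation_int_pow_char_eq_zero p D q)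
  -- `P` holds on `adjoin k₀ σ`
  have hPadj : ∀ y ∈ Algebra.adjoin k₀ (σ : Set E), P (((y : E) : L) : FractionRing (MvPolynomial ℕ (ZMod p))) := by
    intro y hy
    induction hy using Algebra.adjoin_induction with
    | mem y hy => exact hσ y hy
    | algebraMap r => exact hPk₀ r
    | add y z _ _ hy hz =>
      have h := hPadd _ _ hy hz
      rw [Subfield.coe_add, Subfield.coe_add]
      exact h
    | mul y z _ _ hy hz =>
      have h := hPmul _ _ hy hz
      rw [Subfield.coe_mul, Subfield.coe_mul]
      exact h
  -- `x = n / d` with `n, d ∈ adjoin k₀ σ`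
  obtain ⟨⟨n, d⟩, hnd⟩ := IsLocalization.surj
    ((IsUnit.submonoid E).comap (algebraMap (Algebra.adjoin k₀ (σ : Set E)) E)) x
  have hd : IsUnit ((d : Algebra.adjoin k₀ (σ : Set E)) : E) := d.2
  have hd0A : ((((d : Algebra.adjoin k₀ (σ : Set E)) : E) : L) : FractionRing (MvPolynomial ℕ (ZMod p))) ≠ 0 := by
    intro h
    apply hd.ne_zero
    have h' : (((d : Algebra.adjoin k₀ (σ : Set E)) : E) : L) = 0 := Subtype.ext h
    exact Subtype.ext h'
  have h' : (x : E) * ((d : Algebra.adjoin k₀ (σ : Set E)) : E) = (n : E) := hnd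
  have h'' : (((x : E) : L) : FractionRing (MvPolynomial ℕ (ZMod p))) * ((((d : Algebra.adjoin k₀ (σ : Set E)) : E) : L) : FractionRing (MvPolynomial ℕ (ZMod p))) =
      (((n : E) : L) : FractionRing (MvPolynomial ℕ (ZMod p))) := by
    have := congrArg (fun y : E => ((y : L) : FractionRing (MvPolynomial ℕ (ZMod p)))) h'
    simpa using this
  have hx : (((x : E) : L) : FractionRing (MvPolynomial ℕ (ZMod p))) =
      (((n : E) : L) : FractionRing (MvPolynomial ℕ (ZMod p))) * (((((d : Algebra.adjoin k₀ (σ : Set E)) : E) : L) : FractionRing (MvPolynomial ℕ (ZMod p))))⁻¹ := by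
    rw [← h'', mul_inv_cancel_right₀ hd0A]
  rw [hx]
  exact hPmul _ _ (hPadj _ n.2) (hPinv _ (hPadj _ d.1.2))

/-! ## 2 The witness -/

/-- **Mac Lane's field is NOT EFT-separably exhausted** (general form: `L` any subfield EQUAL to
`𝓛 = closure(T ∪ Y)`): no level `E ∋ t₀, t₁` essentially of finite type over a perfect field has `L/E` Mac
Lane-separable, because such a level contains every `y_n` (`mem_macLaneLevel_of_macLane`), while its elements
are quotients of `∂/∂s_{M+1}`-constants for `M` beyond the levels of its finitely many generators (the image of
the perfect field consists of `p`-th powers) and `∂y_M/∂s_{M+1} = s_{M+2}^p ≠ 0`.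
[cite: MacLane1939SteinitzTowers, §8 Lemma 8.5] [cite: MacLane1939ModularFieldsI, §7 Example (1)] -/
theorem not_exhaustedByEssFiniteType_of_eq_macLaneField (L : Subfield (FractionRing (MvPolynomial ℕ (ZMod p))))
    (hL : L = Subfield.closure (algebraMap (MvPolynomial ℕ (ZMod p)) (FractionRing (MvPolynomial ℕ (ZMod p))) '' ({q | ∃ j : ℕ, q = X j ^ p} ∪ {q | ∃ k : ℕ, q = X k + X (k + 1) * X (k + 2) ^ p}))) :
    ¬ ∀ s : Finset L,
      ∃ (k₀ : Type) (_ : Field k₀) (_ : PerfectField k₀) (E : Subfield L) (_ : Algebra k₀ E),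
        Algebra.EssFiniteType k₀ E ∧ (↑s : Set L) ⊆ E ∧
        ∀ u : Finset L, LinearIndepOn E _root_.id (↑u : Set L) →
          LinearIndepOn E (fun y : L => y ^ p) (↑u : Set L) := by
  classical
  have hp : p.Prime := Fact.out
  have f_inj : Function.Injective (algebraMap (MvPolynomial ℕ (ZMod p)) (FractionRing (MvPolynomial ℕ (ZMod p)))) := IsFractionRing.injective _ _
  haveI : CharP (FractionRing (MvPolynomial ℕ (ZMod p))) p := charP_of_injective_algebraMap f_inj p
  haveI : CharP L p := L.subtype.charP Subtype.val_injective p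
  have htL : ∀ j : ℕ, algebraMap (MvPolynomial ℕ (ZMod p)) (FractionRing (MvPolynomial ℕ (ZMod p))) (X j) ^ p ∈ L := fun j => by
    rw [hL, ← map_pow]; exact Subfield.subset_closure ⟨_, Or.inl ⟨j, rfl⟩, rfl⟩
  have hyL : ∀ k : ℕ, algebraMap (MvPolynomial ℕ (ZMod p)) (FractionRing (MvPolynomial ℕ (ZMod p))) (X k + X (k + 1) * X (k + 2) ^ p) ∈ L := fun k => by
    rw [hL]; exact Subfield.subset_closure ⟨_, Or.inr ⟨k, rfl⟩, rfl⟩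
  intro hk
  obtain ⟨k₀, hF, hP, E, hAlg, hEFT, hsub, hML⟩ :=
    hk {⟨algebraMap (MvPolynomial ℕ (ZMod p)) (FractionRing (MvPolynomial ℕ (ZMod p))) (X 0) ^ p, htL 0⟩, ⟨algebraMap (MvPolynomial ℕ (ZMod p)) (FractionRing (MvPolynomial ℕ (ZMod p))) (X 1) ^ p, htL 1⟩}
  have h0 : (⟨algebraMap (MvPolynomial ℕ (ZMod p)) (FractionRing (MvPolynomial ℕ (ZMod p))) (X 0) ^ p, htL 0⟩ : L) ∈ E := hsub (by simp)
  have h1 : (⟨algebraMap (MvPolynomial ℕ (ZMod p)) (FractionRing (MvPolynomial ℕ (ZMod p))) (X 1) ^ p, htL 1⟩ : L) ∈ E := hsub (by simp)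
  -- every `y_n` lies in `E`
  have hyE : ∀ n : ℕ, (⟨algebraMap (MvPolynomial ℕ (ZMod p)) (FractionRing (MvPolynomial ℕ (ZMod p))) (X n + X (n + 1) * X (n + 2) ^ p), hyL n⟩ : L) ∈ E := by
    intro n
    have h := (mem_macLaneLevel_of_macLane p L hL E hML (Subfield.mem_map.2 ⟨_, h0, rfl⟩)
      (Subfield.mem_map.2 ⟨_, h1, rfl⟩) n).2
    obtain ⟨y, hy, hyv⟩ := Subfield.mem_map.1 h
    have : y = ⟨algebraMap (MvPolynomial ℕ (ZMod p)) (FractionRing (MvPolynomial ℕ (ZMod p))) (X n + X (n + 1) * X (n + 2) ^ p), hyL n⟩ := Subtype.ext hyv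
    exact this ▸ hy
  -- the generators of `E` over `k₀` and a common level `M`
  obtain ⟨σ, hσ⟩ := hEFT.cond
  have hgen : ∀ e ∈ σ, ∃ m : ℕ, ((e : L) : FractionRing (MvPolynomial ℕ (ZMod p))) ∈ Subfield.closure (algebraMap (MvPolynomial ℕ (ZMod p)) (FractionRing (MvPolynomial ℕ (ZMod p))) '' ({q | ∃ j : ℕ, q = X j ^ p} ∪ {q | ∃ k : ℕ, k < m ∧ q = X k + X (k + 1) * X (k + 2) ^ p})) :=
    fun e _ => exists_level_of_mem_macLaneField p (by rw [← hL]; exact (e : L).2)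
  choose lev hlev using hgen
  let M : ℕ := σ.attach.sup fun e => lev e.1 e.2
  have hMle : ∀ e (he : e ∈ σ), lev e he ≤ M := fun e he =>
    Finset.le_sup (f := fun e : {x // x ∈ σ} => lev e.1 e.2) (Finset.mem_attach σ ⟨e, he⟩)
  -- the derivation `∂/∂s_{M+1}`
  let c : ℕ → MvPolynomial ℕ (ZMod p) := fun j => if j = M + 1 then 1 else 0
  let D := mkDerivation (ZMod p) c
  have hDp : ∀ q : MvPolynomial ℕ (ZMod p), D (q ^ p) = 0 := fun q => derivation_pow_char_eq_zero p D q
  have hDY : ∀ k, k < M → D (X k + X (k + 1) * X (k + 2) ^ p) = 0 := fun k hk => by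
    show mkDerivation (ZMod p) c _ = 0
    rw [mkDerivation_macLaneY]
    simp only [c, if_neg (show k ≠ M + 1 by omega), if_neg (show k + 1 ≠ M + 1 by omega), mul_zero, add_zero]
  have hDM : D (X M + X (M + 1) * X (M + 2) ^ p) = X (M + 2) ^ p := by
    show mkDerivation (ZMod p) c _ = _
    rw [mkDerivation_macLaneY]
    simp only [c, if_neg (show M ≠ M + 1 by omega), if_pos rfl, mul_one, zero_add]
  -- every element of `E` is a quotient of `D`-constants
  have hσP : ∀ e ∈ σ, ∃ a b : MvPolynomial ℕ (ZMod p), (D.restrictScalars ℤ) a = 0 ∧ (D.restrictScalars ℤ) b = 0 ∧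
      algebraMap (MvPolynomial ℕ (ZMod p)) (FractionRing (MvPolynomial ℕ (ZMod p))) a / algebraMap (MvPolynomial ℕ (ZMod p)) (FractionRing (MvPolynomial ℕ (ZMod p))) b = ((e : L) : FractionRing (MvPolynomial ℕ (ZMod p))) := by
    intro e he
    have hmem : ((e : L) : FractionRing (MvPolynomial ℕ (ZMod p))) ∈ Subfield.closure (algebraMap (MvPolynomial ℕ (ZMod p)) (FractionRing (MvPolynomial ℕ (ZMod p))) ''
        ({q | ∃ j : ℕ, q = X j ^ p} ∪ {q | ∃ k : ℕ, k < M ∧ q = X k + X (k + 1) * X (k + 2) ^ p})) := by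
      refine Subfield.closure_mono (Set.image_mono (Set.union_subset_union_right _ ?_)) (hlev e he)
      rintro q ⟨k, hk, rfl⟩
      exact ⟨k, lt_of_lt_of_le hk (hMle e he), rfl⟩
    have hG : ∀ g ∈ ({q | ∃ j : ℕ, q = X j ^ p} ∪
        {q | ∃ k : ℕ, k < M ∧ q = X k + X (k + 1) * X (k + 2) ^ p} : Set (MvPolynomial ℕ (ZMod p))),
        (D.restrictScalars ℤ) g = 0 := by
      rintro g (⟨j, rfl⟩ | ⟨k, hk, rfl⟩)
      · exact hDp (X j)
      · exact hDY k hk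
    exact exists_eq_div_of_mem_closure_of_derivation_eq_zero (D.restrictScalars ℤ) _ hG hmem
  haveI := hσ
  have hPE := exists_eq_div_of_isLocalization_adjoin p L E k₀ σ (D.restrictScalars ℤ) hσP
  -- but `P` fails on `y_M`
  obtain ⟨a, b, ha, hb, hab⟩ := hPE ⟨⟨algebraMap (MvPolynomial ℕ (ZMod p)) (FractionRing (MvPolynomial ℕ (ZMod p))) (X M + X (M + 1) * X (M + 2) ^ p), hyL M⟩, hyE M⟩
  have ha' : D a = 0 := ha
  have hb' : D b = 0 := hb
  have hab' : algebraMap (MvPolynomial ℕ (ZMod p)) (FractionRing (MvPolynomial ℕ (ZMod p))) a / algebraMap (MvPolynomial ℕ (ZMod p)) (FractionRing (MvPolynomial ℕ (ZMod p))) b = algebraMap (MvPolynomial ℕ (ZMod p)) (FractionRing (MvPolynomial ℕ (ZMod p))) (X M + X (M + 1) * X (M + 2) ^ p) := hab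
  by_cases hb0 : b = 0
  · rw [hb0, map_zero, div_zero] at hab'
    have hzero : (X M + X (M + 1) * X (M + 2) ^ p : MvPolynomial ℕ (ZMod p)) = 0 :=
      f_inj (by rw [map_zero]; exact hab'.symm)
    have := congrArg D hzero
    rw [hDM, map_zero] at this
    exact pow_ne_zero _ (X_ne_zero (M + 2)) this
  · have hfb : algebraMap (MvPolynomial ℕ (ZMod p)) (FractionRing (MvPolynomial ℕ (ZMod p))) b ≠ 0 := fun h => hb0 (f_inj (by rw [h, map_zero]))
    have hXb : (X M + X (M + 1) * X (M + 2) ^ p) * b = a :=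
      f_inj (by rw [map_mul, ← hab', div_mul_cancel₀ _ hfb])
    have := congrArg D hXb
    rw [Derivation.leibniz, hb', smul_zero, zero_add, ha', hDM, smul_eq_mul] at this
    exact hb0 ((mul_eq_zero.mp this).resolve_right (pow_ne_zero _ (X_ne_zero (M + 2))))

/-- **THE WITNESS, packaged**: there is a subfield `L` of the rational function field
`Frac(𝔽_p[s₀, s₁, …])` — namely Mac Lane's `𝓛 = 𝔽_p(T, Y)`, `T = {s_j^p}`, `Y = {s_k + s_{k+1} s_{k+2}^p}` — that is
NOT EFT-separably exhausted (the residual class of `descentPerfectToAll_iff_residual`, verbatim shape, for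
`k = L`). [cite: MacLane1939SteinitzTowers, §8 Lemma 8.5] [cite: MacLane1939ModularFieldsI, §7 Example (1)] -/
theorem exists_macLaneField_not_exhaustedByEssFiniteType :
    ∃ L : Subfield (FractionRing (MvPolynomial ℕ (ZMod p))), L = Subfield.closure (algebraMap (MvPolynomial ℕ (ZMod p)) (FractionRing (MvPolynomial ℕ (ZMod p))) '' ({q | ∃ j : ℕ, q = X j ^ p} ∪ {q | ∃ k : ℕ, q = X k + X (k + 1) * X (k + 2) ^ p})) ∧
    ¬ ∀ s : Finset L,
      ∃ (k₀ : Type) (_ : Field k₀) (_ : PerfectField k₀) (E : Subfield L) (_ : Algebra k₀ E),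
        Algebra.EssFiniteType k₀ E ∧ (↑s : Set L) ⊆ E ∧
        ∀ u : Finset L, LinearIndepOn E _root_.id (↑u : Set L) →
          LinearIndepOn E (fun y : L => y ^ p) (↑u : Set L) :=
  ⟨_, rfl, not_exhaustedByEssFiniteType_of_eq_macLaneField p _ rfl⟩

end Summit.ResolutionOfSingularities.ResolutionOfSingularities.Theorems

end
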